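import Literature.NumberTheory.Sieve.AsymptoticSieveForPrimesTheorem2Density
import Literature.NumberTheory.Sieve.FriedlanderIwaniecPrimesSquarefreeProofs
import HarnessLib

/-!
# Asymptotic sieve for primes, Theorem 2: inclusion–exclusion for `Ã_d`, the exact main term, and the pointwise decomposition of `r̃_d`

Topic `Literature/NumberTheory/Sieve` (trunk T-SIEVE), sequel of
`Literature.NumberTheory.Sieve.AsymptoticSieveForPrimesTheorem2Density`. Source: J. Friedlander,
H. Iwaniec, *Asymptotic sieve for primes*, Ann. of Math. 148 (1998) 1041–1065
[FriedlanderIwaniecASP1998] (= arXiv:math/9811186), §9 pp. 1061–1062: "Detecting squarefree numbers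
by the Möbius formula `μ²(n) = ∑_{ν² ∣ n} μ(ν)` we get, for `d` squarefree,
`Ã_d(x) = ∑_ν μ(ν) A_{[ν²,d]}(x) = g̃(d) G A(x) + ∑_ν μ(ν) r_{[ν²,d]}(x)` where `G = ∏_p (1 - g(p²))`,
so that (9.9) `g̃(d) G = ∑_ν μ(ν) g([ν²,d])` … Hence
`r̃_d(x) = ∑_ν μ(ν) (r_{[ν²,d]}(x) - g̃(d) r_{ν²}(x))`."

For a GENERAL sifted sequence `A` (the tree's `FriedlanderIwaniecPrimesSquarefreeProofs`, Parts B–C,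
does this for FI's specific sequence `#{(a,c) : a² + c⁴ = n}`; the proofs below are those, with the
sequence and its density abstracted), in the finite form used by the tree: the squarefree `ν` are
indexed by the subsets `L` of the primes `T = {p ≤ X}` (`ν = ℓ_L = ∏_{p∈L} p`), so that every sum is
finite and the main term is an EXACT finite Euler product:

* `SieveSequence.moebiusSq_congrSum_eq_sum` — `Ã_d(t) = ∑_{L ⊆ T} (-1)^{|L|} A_{lcm(d, ℓ_L²)}(t)` for
  `⌊t⌋ ≤ X`;
* `density_lcm_sq` — `g(lcm(d, ℓ_L²)) = ∏_{p ∣ d, p ∉ L} g(p) ∏_{p ∈ L} g(p²)` (`d` squarefree);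
* `sum_neg_one_pow_mul_density_lcm` — (9.9) in finite form:
  `∑_{L ⊆ T} (-1)^{|L|} g(lcm(d, ℓ_L²)) = g̃(d) ∏_{p ∈ T} (1 - g(p²))` for squarefree `d` with prime
  factors in `T` (`Finset.prod_add`);
* `SieveSequence.abs_moebiusSq_congrSum_sub_main_le` — truncating at `ℓ_L ≤ Λ`:
  `|Ã_d(t) - g̃(d) G_T A(t)| ≤ A(t) TG_d + RS_d(t) + ES_d(t)` with
  `TG_d = ∑_{ℓ_L > Λ} g(lcm(d,ℓ_L²))`, `RS_d(t) = ∑_{ℓ_L ≤ Λ} |r_{lcm(d,ℓ_L²)}(t)|`,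
  `ES_d(t) = ∑_{ℓ_L > Λ} A_{lcm(d,ℓ_L²)}(t)`, `G_T = ∏_{p ≤ X} (1 - g(p²))` (`sqProd`);
* `SieveSequence.abs_moebiusSq_remainder_le` —
  `|r̃_d(t)| ≤ (A(t) TG_d + RS_d(t) + ES_d(t)) + g̃(d)(A(t) TG_1 + RS_1(t) + ES_1(t))`.

The estimation of `TG`, `RS`, `ES` (FI's `E₁`, `E₂₁`, `E₂₂`, pp. 1061–1062) and the deduction of
Theorem 2 / [FriedlanderIwaniecAnnals1998] Proposition 2.1 are in the sequels.

## References

* J. Friedlander, H. Iwaniec, *Asymptotic sieve for primes*, Ann. of Math. 148 (1998), 1041–1065,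
  §9 (9.6)–(9.10), pp. 1061–1062. [cite: FriedlanderIwaniecASP1998, §9 (9.6)-(9.10)]

## Mathlib / tree search

Tree (reused): `ite_squarefree_eq_sum`, `lcm_sq_dvd_iff`, `lcm_sq_eq_prod`, `squarefree_prod_of_primes`
(`FriedlanderIwaniecPrimesSquarefreeProofs`, namespace `…FriedlanderIwaniecPrimesSquarefree`);
patterns generalised from `congrSumSq_eq_sum`, `fiDensity_lcm_sq`, `sum_neg_one_pow_mul_fiDensity_lcm`,
`abs_congrSumSq_sub_main_le`, `abs_remainderSq_le` (same file, FI's specific sequence);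
`moebiusSq`, `moebiusSqDensity`, `sqProd` (`…Theorem2Density`). Mathlib: `Finset.prod_add`,
`Finset.sum_powerset_neg_one_pow_card`. `lean search 'moebiusSq_congrSum_eq_sum|density_lcm_sq'`:
nothing before this file.
-/

noncomputable section

open Filter Finset Real
open scoped ArithmeticFunction.sigma

namespace Literature.NumberTheory.Sieve

open FriedlanderIwaniecPrimesSquarefree

/-! ### Inclusion–exclusion for `Ã_d` -/

namespace SieveSequence

variable (A : SieveSequence)

/-- **Inclusion–exclusion for `Ã_d`** ("detecting squarefree numbers by the Möbius formula",
FI p. 1061): for `⌊t⌋ ≤ X`, `Ã_d(t) = ∑_{L ⊆ {p ≤ X}} (-1)^{|L|} A_{lcm(d, ℓ_L²)}(t)`,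
`ℓ_L = ∏_{p ∈ L} p`. [cite: FriedlanderIwaniecASP1998, §9 p. 1061] -/
theorem moebiusSq_congrSum_eq_sum (d : ℕ) {t : ℝ} {X : ℕ} (ht : ⌊t⌋₊ ≤ X) :
    A.moebiusSq.congrSum d t = ∑ L ∈ (Nat.primesLE X).powerset,
      (-1 : ℝ) ^ #L * A.congrSum (Nat.lcm d ((∏ p ∈ L, p) ^ 2)) t := by
  set T := Nat.primesLE X with hT
  have hTp : ∀ p ∈ T, p.Prime := fun p hp => Nat.prime_of_mem_primesLE hp
  -- expand `ã_n`
  have h1 : A.moebiusSq.congrSum d t = ∑ n ∈ (Ioc 0 ⌊t⌋₊).filter (d ∣ ·),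
      A.a n * ∑ L ∈ T.powerset with (∀ p ∈ L, p ^ 2 ∣ n), (-1 : ℝ) ^ #L := by
    unfold SieveSequence.congrSum
    refine Finset.sum_congr rfl fun n hn => ?_
    have hn' := Finset.mem_filter.mp hn
    have hn0 : n ≠ 0 := (Finset.mem_Ioc.mp hn'.1).1.ne'
    have hnX : n ≤ X := (Finset.mem_Ioc.mp hn'.1).2.trans ht
    rw [moebiusSq_a, ← ite_squarefree_eq_sum hTp]
    · split_ifs <;> simp
    · intro p hp hpn
      rw [hT, Nat.mem_primesLE]
      refine ⟨?_, hp⟩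
      have : p ^ 2 ≤ n := Nat.le_of_dvd (Nat.pos_of_ne_zero hn0) hpn
      calc p ≤ p ^ 2 := Nat.le_self_pow two_ne_zero p
        _ ≤ X := this.trans hnX
  rw [h1]
  have h2 : ∀ n ∈ (Ioc 0 ⌊t⌋₊).filter (d ∣ ·),
      A.a n * ∑ L ∈ T.powerset with (∀ p ∈ L, p ^ 2 ∣ n), (-1 : ℝ) ^ #L =
        ∑ L ∈ T.powerset, (if (∀ p ∈ L, p ^ 2 ∣ n) then A.a n * (-1 : ℝ) ^ #L else 0) := by
    intro n _
    rw [Finset.sum_filter, Finset.mul_sum]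
    refine Finset.sum_congr rfl fun L _ => ?_
    split_ifs <;> simp
  rw [Finset.sum_congr rfl h2, Finset.sum_comm]
  refine Finset.sum_congr rfl fun L hL => ?_
  have hLp : ∀ p ∈ L, p.Prime := fun p hp => hTp p (Finset.mem_powerset.mp hL hp)
  rw [← Finset.sum_filter, Finset.filter_filter, SieveSequence.congrSum, Finset.mul_sum]
  have hset : (Ioc 0 ⌊t⌋₊).filter (fun n => d ∣ n ∧ ∀ p ∈ L, p ^ 2 ∣ n) =
      (Ioc 0 ⌊t⌋₊).filter (fun n => Nat.lcm d ((∏ p ∈ L, p) ^ 2) ∣ n) :=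
    Finset.filter_congr fun n _ => (lcm_sq_dvd_iff d hLp n).symm
  rw [hset]
  refine Finset.sum_congr rfl fun n _ => ?_
  ring

end SieveSequence

/-! ### The main term: an exact Euler product ((9.9) in finite form) -/

variable {g : ArithmeticFunction ℝ}

/-- `g(lcm(d, ℓ_L²)) = ∏_{p ∣ d, p ∉ L} g(p) · ∏_{p ∈ L} g(p²)` for squarefree `d` and a set of primes
`L`, by multiplicativity. [folklore] -/
theorem density_lcm_sq (hg : g.IsMultiplicative) {d : ℕ} (hd : Squarefree d) {L : Finset ℕ}
    (hL : ∀ p ∈ L, p.Prime) :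
    g (Nat.lcm d ((∏ p ∈ L, p) ^ 2)) = (∏ p ∈ d.primeFactors \ L, g p) * ∏ p ∈ L, g (p ^ 2) := by
  classical
  rw [lcm_sq_eq_prod hd hL]
  have hcop : (∏ p ∈ d.primeFactors \ L, p).Coprime (∏ p ∈ L, p ^ 2) := by
    refine Nat.Coprime.prod_left fun p hp => Nat.Coprime.prod_right fun q hq => ?_
    have hp' := Finset.mem_sdiff.mp hp
    exact Nat.Coprime.pow_right 2 ((Nat.coprime_primes (Nat.prime_of_mem_primeFactors hp'.1)
      (hL q hq)).mpr (fun h => hp'.2 (h ▸ hq)))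
  rw [hg.map_mul_of_coprime hcop,
    hg.map_prod_of_prime _ (fun p hp => Nat.prime_of_mem_primeFactors (Finset.mem_sdiff.mp hp).1),
    hg.map_prod (fun p => p ^ 2)]
  intro p hp q hq hpq
  exact Nat.coprime_pow_primes 2 2 (hL p hp) (hL q hq) hpq

/-- Variant: `g(lcm(d, ℓ_L²)) = g(∏_{p ∣ d, p ∉ L} p) · ∏_{p ∈ L} g(p²)`, the first factor being `g` of a
squarefree divisor of `d`. [folklore] -/
theorem density_lcm_sq' (hg : g.IsMultiplicative) {d : ℕ} (hd : Squarefree d) {L : Finset ℕ}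
    (hL : ∀ p ∈ L, p.Prime) :
    g (Nat.lcm d ((∏ p ∈ L, p) ^ 2)) = g (∏ p ∈ d.primeFactors \ L, p) * ∏ p ∈ L, g (p ^ 2) := by
  rw [density_lcm_sq hg hd hL, hg.map_prod_of_prime _
    (fun p hp => Nat.prime_of_mem_primeFactors (Finset.mem_sdiff.mp hp).1)]

/-- `g(lcm(d, ℓ_L²)) ≥ 0` for squarefree `d` under (2.4). [folklore] -/
theorem density_lcm_sq_nonneg (hg : g.IsMultiplicative)
    (h24 : ∀ p : ℕ, p.Prime → 0 ≤ g (p ^ 2) ∧ g (p ^ 2) ≤ g p ∧ g p < 1) {d : ℕ}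
    (hd : Squarefree d) {L : Finset ℕ} (hL : ∀ p ∈ L, p.Prime) :
    0 ≤ g (Nat.lcm d ((∏ p ∈ L, p) ^ 2)) := by
  rw [density_lcm_sq hg hd hL]
  exact mul_nonneg (Finset.prod_nonneg fun p hp =>
      (h24 p (Nat.prime_of_mem_primeFactors (Finset.mem_sdiff.mp hp).1)).1.trans
        (h24 p (Nat.prime_of_mem_primeFactors (Finset.mem_sdiff.mp hp).1)).2.1)
    (Finset.prod_nonneg fun p hp => (h24 p (hL p hp)).1)

/-- **The main term is an exact Euler product** ((9.9) in finite form): for squarefree `d` with all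
prime factors in the finite set of primes `T`,
`∑_{L ⊆ T} (-1)^{|L|} g(lcm(d, ℓ_L²)) = g̃(d) ∏_{p ∈ T} (1 - g(p²))`
(expand `∏_{p ∈ T} (u_p - g(p²))` with `u_p = g(p)` for `p ∣ d` and `u_p = 1` otherwise, and use
`g̃(p)(1 - g(p²)) = g(p) - g(p²)`). [cite: FriedlanderIwaniecASP1998, (9.9)] -/
theorem sum_neg_one_pow_mul_density_lcm (hg : g.IsMultiplicative)
    (h24 : ∀ p : ℕ, p.Prime → 0 ≤ g (p ^ 2) ∧ g (p ^ 2) ≤ g p ∧ g p < 1) {d : ℕ}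
    (hd : Squarefree d) {T : Finset ℕ} (hT : ∀ p ∈ T, p.Prime) (hdT : d.primeFactors ⊆ T) :
    ∑ L ∈ T.powerset, (-1 : ℝ) ^ #L * g (Nat.lcm d ((∏ p ∈ L, p) ^ 2)) =
      moebiusSqDensity g d * ∏ p ∈ T, (1 - g (p ^ 2)) := by
  classical
  set D := d.primeFactors with hD
  set u : ℕ → ℝ := fun p => if p ∈ D then g p else 1 with hu
  set v : ℕ → ℝ := fun p => -g (p ^ 2) with hv
  -- each term is `(∏_{L} v)(∏_{T \ L} u)`
  have hterm : ∀ L ∈ T.powerset, (-1 : ℝ) ^ #L * g (Nat.lcm d ((∏ p ∈ L, p) ^ 2)) =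
      (∏ p ∈ L, v p) * ∏ p ∈ T \ L, u p := by
    intro L hL
    have hLT := Finset.mem_powerset.mp hL
    have hLp : ∀ p ∈ L, p.Prime := fun p hp => hT p (hLT hp)
    rw [density_lcm_sq hg hd hLp]
    have h1 : ∏ p ∈ T \ L, u p = ∏ p ∈ D \ L, g p := by
      rw [hu, Finset.prod_ite_mem]
      · congr 1
        ext p
        simp only [Finset.mem_inter, Finset.mem_sdiff]
        constructor
        · rintro ⟨⟨-, h2⟩, h3⟩; exact ⟨h3, h2⟩
        · rintro ⟨h1, h2⟩; exact ⟨⟨hdT h1, h2⟩, h1⟩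
    have h2 : ∏ p ∈ L, v p = (-1 : ℝ) ^ #L * ∏ p ∈ L, g (p ^ 2) := by
      rw [hv, Finset.prod_neg]
    rw [h1, h2]; ring
  rw [Finset.sum_congr rfl hterm, ← Finset.prod_add]
  -- `∏_{p ∈ T} (v_p + u_p) = ∏_{p ∈ D} (g(p) - g(p²)) ∏_{p ∈ T \ D} (1 - g(p²))`
  rw [← Finset.prod_sdiff hdT]
  have hD1 : ∏ p ∈ D, (v p + u p) = ∏ p ∈ D, (moebiusSqDensity g p * (1 - g (p ^ 2))) := by
    refine Finset.prod_congr rfl fun p hp => ?_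
    rw [moebiusSqDensity_prime_mul_one_sub (Nat.prime_of_mem_primeFactors hp)
      (h24 p (Nat.prime_of_mem_primeFactors hp)), hu, hv]
    simp only [if_pos hp]; ring
  have hD2 : ∏ p ∈ T \ D, (v p + u p) = ∏ p ∈ T \ D, (1 - g (p ^ 2)) := by
    refine Finset.prod_congr rfl fun p hp => ?_
    rw [hu, hv]
    simp only [if_neg (Finset.mem_sdiff.mp hp).2]; ring
  rw [hD1, hD2, Finset.prod_mul_distrib, moebiusSqDensity_eq_prod_of_squarefree g hd, ← hD]
  rw [← Finset.prod_sdiff hdT (f := fun p => 1 - g (p ^ 2))]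
  ring

/-! ### The pointwise decomposition of `Ã_d` and `r̃_d` -/

namespace SieveSequence

variable (A : SieveSequence)

/-- **Pointwise decomposition** (FI p. 1061, finite form). For squarefree `d ≤ ⌊x⌋` and `t ≤ x`, with
`T = {p ≤ ⌊x⌋}`, `G_T = ∏_{p ∈ T} (1 - g(p²))` and a truncation parameter `Λ`:
`|Ã_d(t) - g̃(d) G_T A_1(t)| ≤ A_1(t) ∑_{L ⊆ T, ℓ_L > Λ} g(lcm(d,ℓ_L²))`
`+ ∑_{L ⊆ T, ℓ_L ≤ Λ} |r_{lcm(d,ℓ_L²)}(t)| + ∑_{L ⊆ T, ℓ_L > Λ} A_{lcm(d,ℓ_L²)}(t)`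
(here `r_m(t) = A_m(t) - g(m) A_1(t)`, the size being normalised by `size_eq`).
[cite: FriedlanderIwaniecASP1998, §9 p. 1061] -/
theorem abs_moebiusSq_congrSum_sub_main_le (hsize : ∀ t, A.size t = A.congrSum 1 t)
    (h24 : ∀ p : ℕ, p.Prime → 0 ≤ A.density (p ^ 2) ∧ A.density (p ^ 2) ≤ A.density p ∧
      A.density p < 1)
    {d : ℕ} (hd : Squarefree d) {x t : ℝ} (hdx : d ≤ ⌊x⌋₊) (htx : t ≤ x) (Λ : ℕ) :
    |A.moebiusSq.congrSum d t - moebiusSqDensity A.density d * sqProd A.density ⌊x⌋₊ *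
        A.congrSum 1 t| ≤
      A.congrSum 1 t * ∑ L ∈ (Nat.primesLE ⌊x⌋₊).powerset with ¬(∏ p ∈ L, p) ≤ Λ,
          A.density (Nat.lcm d ((∏ p ∈ L, p) ^ 2)) +
      ∑ L ∈ (Nat.primesLE ⌊x⌋₊).powerset with (∏ p ∈ L, p) ≤ Λ,
          |A.remainder (Nat.lcm d ((∏ p ∈ L, p) ^ 2)) t| +
      ∑ L ∈ (Nat.primesLE ⌊x⌋₊).powerset with ¬(∏ p ∈ L, p) ≤ Λ,
          A.congrSum (Nat.lcm d ((∏ p ∈ L, p) ^ 2)) t := by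
  set X := ⌊x⌋₊ with hX
  set T := Nat.primesLE X with hT
  set g := A.density with hg
  have hgm : g.IsMultiplicative := A.density_mult
  have hTp : ∀ p ∈ T, p.Prime := fun p hp => Nat.prime_of_mem_primesLE hp
  have hdT : d.primeFactors ⊆ T := fun p hp => by
    rw [hT, Nat.mem_primesLE]
    exact ⟨(Nat.le_of_mem_primeFactors hp).trans hdx, Nat.prime_of_mem_primeFactors hp⟩
  set s : Finset ℕ → ℝ := fun L => (-1 : ℝ) ^ #L with hs
  set m : Finset ℕ → ℕ := fun L => Nat.lcm d ((∏ p ∈ L, p) ^ 2) with hm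
  have hs1 : ∀ L, |s L| = 1 := fun L => by simp [hs]
  -- inclusion–exclusion and the split small/big
  have h1 := A.moebiusSq_congrSum_eq_sum d (Nat.floor_mono htx : ⌊t⌋₊ ≤ X)
  rw [← Finset.sum_filter_add_sum_filter_not _ (fun L => (∏ p ∈ L, p) ≤ Λ)] at h1
  -- on the small part, `A_m = g(m) A_1(t) + r_m(t)`
  have hsmall : ∑ L ∈ T.powerset with (∏ p ∈ L, p) ≤ Λ, s L * A.congrSum (m L) t =
      A.congrSum 1 t * ∑ L ∈ T.powerset with (∏ p ∈ L, p) ≤ Λ, s L * g (m L) +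
        ∑ L ∈ T.powerset with (∏ p ∈ L, p) ≤ Λ, s L * A.remainder (m L) t := by
    rw [Finset.mul_sum, ← Finset.sum_add_distrib]
    refine Finset.sum_congr rfl fun L _ => ?_
    rw [SieveSequence.remainder, hsize t]; ring
  -- the full main sum is `g̃(d) G_T`
  have hmain := sum_neg_one_pow_mul_density_lcm hgm h24 hd hTp hdT
  rw [← Finset.sum_filter_add_sum_filter_not _ (fun L => (∏ p ∈ L, p) ≤ Λ)] at hmain
  have hP : ∏ p ∈ T, (1 - g (p ^ 2)) = sqProd g X := rfl
  -- assemble the identity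
  have hid : A.moebiusSq.congrSum d t - moebiusSqDensity g d * sqProd g X * A.congrSum 1 t =
      -(A.congrSum 1 t * ∑ L ∈ T.powerset with ¬(∏ p ∈ L, p) ≤ Λ, s L * g (m L)) +
      ∑ L ∈ T.powerset with (∏ p ∈ L, p) ≤ Λ, s L * A.remainder (m L) t +
      ∑ L ∈ T.powerset with ¬(∏ p ∈ L, p) ≤ Λ, s L * A.congrSum (m L) t := by
    rw [h1, hsmall, ← hP, ← hmain]; ring
  rw [hid]
  -- bound each piece by its absolute sum
  have hA := A.congrSum_nonneg 1 t
  refine (abs_add_le _ _).trans (add_le_add ((abs_add_le _ _).trans (add_le_add ?_ ?_)) ?_)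
  · rw [abs_neg, abs_mul, abs_of_nonneg hA]
    refine mul_le_mul_of_nonneg_left ((Finset.abs_sum_le_sum_abs _ _).trans
      (Finset.sum_le_sum fun L hL => ?_)) hA
    rw [abs_mul, hs1, one_mul, abs_of_nonneg]
    exact density_lcm_sq_nonneg hgm h24 hd
      fun p hp => hTp p (Finset.mem_powerset.mp (Finset.mem_filter.mp hL).1 hp)
  · refine (Finset.abs_sum_le_sum_abs _ _).trans (Finset.sum_le_sum fun L _ => ?_)
    rw [abs_mul, hs1, one_mul]
  · refine (Finset.abs_sum_le_sum_abs _ _).trans (Finset.sum_le_sum fun L _ => ?_)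
    rw [abs_mul, hs1, one_mul, abs_of_nonneg (A.congrSum_nonneg _ _)]

/-- **Pointwise bound for `r̃_d(t)`** (`d` squarefree, `d ≤ ⌊x⌋`, `t ≤ x`; FI's
`r̃_d = ∑_ν μ(ν)(r_{[ν²,d]} - g̃(d) r_{ν²})`, p. 1061): with the three error functionals
`TG_d = ∑_{ℓ_L > Λ} g(lcm(d,ℓ_L²))`, `RS_d(t) = ∑_{ℓ_L ≤ Λ} |r_{lcm(d,ℓ_L²)}(t)|`,
`ES_d(t) = ∑_{ℓ_L > Λ} A_{lcm(d,ℓ_L²)}(t)` (sums over `L ⊆ {p ≤ ⌊x⌋}`),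
`|r̃_d(t)| ≤ (A_1(t) TG_d + RS_d(t) + ES_d(t)) + g̃(d) (A_1(t) TG_1 + RS_1(t) + ES_1(t))`.
[cite: FriedlanderIwaniecASP1998, §9 p. 1061] -/
theorem abs_moebiusSq_remainder_le (hsize : ∀ t, A.size t = A.congrSum 1 t)
    (h24 : ∀ p : ℕ, p.Prime → 0 ≤ A.density (p ^ 2) ∧ A.density (p ^ 2) ≤ A.density p ∧
      A.density p < 1)
    {d : ℕ} (hd : Squarefree d) {x t : ℝ} (hdx : d ≤ ⌊x⌋₊) (hx : 1 ≤ x) (htx : t ≤ x) (Λ : ℕ) :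
    |A.moebiusSq.remainder d t| ≤
      (A.congrSum 1 t * ∑ L ∈ (Nat.primesLE ⌊x⌋₊).powerset with ¬(∏ p ∈ L, p) ≤ Λ,
          A.density (Nat.lcm d ((∏ p ∈ L, p) ^ 2)) +
        ∑ L ∈ (Nat.primesLE ⌊x⌋₊).powerset with (∏ p ∈ L, p) ≤ Λ,
          |A.remainder (Nat.lcm d ((∏ p ∈ L, p) ^ 2)) t| +
        ∑ L ∈ (Nat.primesLE ⌊x⌋₊).powerset with ¬(∏ p ∈ L, p) ≤ Λ,
          A.congrSum (Nat.lcm d ((∏ p ∈ L, p) ^ 2)) t) +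
      moebiusSqDensity A.density d *
        (A.congrSum 1 t * ∑ L ∈ (Nat.primesLE ⌊x⌋₊).powerset with ¬(∏ p ∈ L, p) ≤ Λ,
            A.density (Nat.lcm 1 ((∏ p ∈ L, p) ^ 2)) +
          ∑ L ∈ (Nat.primesLE ⌊x⌋₊).powerset with (∏ p ∈ L, p) ≤ Λ,
            |A.remainder (Nat.lcm 1 ((∏ p ∈ L, p) ^ 2)) t| +
          ∑ L ∈ (Nat.primesLE ⌊x⌋₊).powerset with ¬(∏ p ∈ L, p) ≤ Λ,
            A.congrSum (Nat.lcm 1 ((∏ p ∈ L, p) ^ 2)) t) := by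
  have h1x : 1 ≤ ⌊x⌋₊ := Nat.le_floor (by simpa using hx)
  have hd' := A.abs_moebiusSq_congrSum_sub_main_le hsize h24 hd hdx htx Λ
  have h1' := A.abs_moebiusSq_congrSum_sub_main_le hsize h24 squarefree_one h1x htx Λ
  rw [(isMultiplicative_moebiusSqDensity A.density).map_one, one_mul] at h1'
  have hgd : 0 ≤ moebiusSqDensity A.density d := moebiusSqDensity_nonneg A.density_mult h24 d
  have hid : A.moebiusSq.remainder d t =
      (A.moebiusSq.congrSum d t - moebiusSqDensity A.density d * sqProd A.density ⌊x⌋₊ *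
          A.congrSum 1 t) -
        moebiusSqDensity A.density d *
          (A.moebiusSq.congrSum 1 t - sqProd A.density ⌊x⌋₊ * A.congrSum 1 t) := by
    rw [SieveSequence.remainder, moebiusSq_size_eq, moebiusSq_density]
    ring
  rw [hid]
  refine (abs_sub _ _).trans (add_le_add hd' ?_)
  rw [abs_mul, abs_of_nonneg hgd]
  exact mul_le_mul_of_nonneg_left h1' hgd

end SieveSequence

end Literature.NumberTheory.Sieve
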